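import Literature.AnabelianGeometry.EtaleTheta.Discharge.Sec1Thm16Schema
import Literature.AnabelianGeometry.EtaleTheta.SettingModelChiKummerDataNondeg
import HarnessLib

/-!
# [EtTh] Thm. 1.6 (ii)/(iii), Prop. 1.5 (iii) as typed: the universal closures are FALSE — unguarded, at the
# χ-twisted root model carrying Kummer data (FACT-LIST rows F-0586, F-0587, F-0591; proof-only)

Mochizuki, *The étale theta function …*, Publ. RIMS **45** (2009) [EtTh], §1, Prop. 1.5 (iii) (PRIMS PDF p. 23) and
Thm. 1.6 (ii)/(iii) (PRIMS PDF pp. 24–25) [cite: MochizukiEtTh2009, Thm 1.6 p.24]. PROOF-ONLY file (abc-iut cell, block F,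
seat abc-iut-f-139 gen 2, tranche 139; rows **F-0586** `Literature.AnabelianGeometry.EtaleTheta.ThetaSetting.Thm16ii`,
**F-0587** `….Thm16iii` (trunk `TemperedRigidity.lean`), **F-0591** `….Prop15iii` (trunk `ThetaCohomology.lean`); all
parametrised). No definition, no instance, no new named fact. Imported, never edited: abc-iut-f-114's
`Discharge/Sec1Thm16Schema.lean` (p430082) and abc-iut-f-117's `Discharge/Sec1Prop15Schema.lean` (p429009) — the GUARDED
verdicts «closure false as soon as SOME theta setting at an [EtTh] origin carries Kummer data» — and abc-iut-w5-d171's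
`SettingModelChiKummerData(Nondeg).lean` (p433761 / p434189): the first inhabitant `SettingModel.kummerDataχ :
(ThetaSetting.modelχ p).KummerData`, at a setting with `ThetaSetting.modelχ_isEtThOrigin` and (as every setting)
`ThetaSetting.compat`. The existential guards are thereby DISCHARGED; every `¬ ∀` below is hypothesis-free:

* bricks: `ContH1.mk_zpow`, `ContH1.apply_eq_of_mk_eq_mk` (cocycles with the same class agree at every element acting
  trivially on the coefficients); `KummerData.infl_kumYdd_qddUnit_not_mem_kumUnitsYdd` (for EVERY Kummer datum the class
  of the non-unit `q̈` is not a unit class: injectivity + `‖q̈‖ < 1`), `kumUnitsYdd_ne_top`;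
  `KummerCore.apply_eq_one_of_kumYdd_eq_mk` (Kummer cocycles of constants VANISH at elements of `(Π^tp_Ÿ)^Θ` with trivial
  Galois image), `KummerCore.toInvYdd_surjective`, `ValuationHatData.unitsHat_eq_of_surjective`;
* **F-0591** — `not_forall_prop15iii_modelχ`, `exists_not_prop15iii_modelχ`, and the fully quantified
  `ThetaSetting.not_forall_prop15iii` (the LEFT side of f-117's `forall_prop15iii_iff_forall_isEmpty_kummerData`);
* **F-0587** — `not_forall_thm16iii_refl_of_nonempty_kummerData` (any setting with Kummer data, `γ = id`),
  `not_forall_thm16iii_modelχ`, `exists_not_thm16iii_modelχ`, the fully quantified `ThetaSetting.not_forall_thm16iii`;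
* **F-0586** — `SettingModel.logUddχ_zpow_eq_kumYdd_imp` (`log(Ü)^k` is a Kummer class of a constant only for `k = 0`:
  evaluate at the geometric element `(b², 0) ⋊ 1`), hence the Kummer datum EXTENDED by the free factor `⟨log(Ü)⟩` is
  again a `KummerData` with `log(Ü)` OFF-LATTICE (`exists_kummerData_offLattice_modelχ`); whence
  `not_forall_thm16ii_modelχ` and the fully quantified `ThetaSetting.not_forall_thm16ii`;
* INSTANCE FORMS (R5: rows consumable at named instances): `SettingModel.thm16ii_refl_kummerDataχ` (at `γ = id` with the
  genuine datum on both sides Thm. 1.6 (ii) HOLDS for ALL valuation data — `K̈^× → (K̈^×)^∧` is onto, the kernel is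
  determined), `SettingModel.thm16iii_refl_self_modelχ` (f-114's `thm16iii_refl_self` at the model).

HONEST FRAMING: statements about the cell's TYPED predicates over abstract interface data, evaluated at a SEMI-SYNTHETIC
model (the χ-twisted root; not the tempered `π₁` of a curve); the printed Prop. 1.5 / Thm. 1.6 are neither asserted nor
denied; a FACT row is an assumption label; typed ≠ proved; no side is taken on [IUTchIII] Cor. 3.12 or on any author.
-/

noncomputable section

namespace Literature.AnabelianGeometry.EtaleTheta

open Literature.AnabelianGeometry.SemiGraphs
open scoped IsMulCommutative

/-! ### Generic `ContH1` bricks -/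

namespace ContH1

variable {G G' : Type*} [Group G] [TopologicalSpace G]
  [Group G'] [TopologicalSpace G'] [IsTopologicalGroup G']
  {φ : G →* G'} {A : Subgroup G'} [A.Normal] [IsMulCommutative A] {H : Subgroup G}

/-- Integer powers of a class are the classes of the powers of a cocycle. [cite: NeukirchSchmidtWingberg2008, I §2] -/
theorem mk_zpow (f : H → A) (hf : f ∈ contCocycles φ A H) (k : ℤ) :
    (ContH1.mk f hf : ContH1 φ A H) ^ k = ContH1.mk (f ^ k) (zpow_mem hf k) := by
  change (QuotientGroup.mk (s := (contCoboundaries φ A H).subgroupOf (contCocycles φ A H))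
      (⟨f, hf⟩ : contCocycles φ A H)) ^ k =
    QuotientGroup.mk (s := (contCoboundaries φ A H).subgroupOf (contCocycles φ A H))
      ((⟨f, hf⟩ : contCocycles φ A H) ^ k)
  exact (QuotientGroup.mk_zpow _ _ _).symm

/-- **Evaluation at an element acting trivially is a class invariant**: two continuous cocycles with the same class
take the SAME value at every `x ∈ H` acting trivially on `A` (principal crossed homomorphisms vanish there).
[cite: NeukirchSchmidtWingberg2008, I §2] -/
theorem apply_eq_of_mk_eq_mk {f g : H → A} {hf : f ∈ contCocycles φ A H} {hg : g ∈ contCocycles φ A H}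
    (hfg : ContH1.mk f hf = ContH1.mk g hg) (x : H)
    (hx : ∀ a : A, MulAut.conjNormal (φ (x : G)) a = a) : f x = g x := by
  obtain ⟨a, ha⟩ := (ContH1.mk_eq_mk_iff H f g hf hg).mp hfg
  have h1 := ha x
  rwa [hx a, mul_inv_cancel, inv_mul_eq_one] at h1

end ContH1

namespace ThetaSetting

variable {p : ℕ} [Fact p.Prime] {D : ThetaSetting p}

/-! ### Generic [EtTh] §1 bricks: the class of `q̈` is not a unit class -/

/-- `q̈ ∉ O^×_K̈`: `‖q̈‖ < 1` since `q̈² = q_X` lies in the maximal ideal (pp. 13, 17). [cite: MochizukiEtTh2009, §1 p.17] -/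
theorem qddUnit_not_mem_unitsOKdd (D : ThetaSetting p) : D.qddUnit ∉ D.unitsOKdd := by
  intro h
  have h1 : ‖D.qdd‖ = 1 := h
  have h2 : ‖D.qdd‖ ^ 2 < 1 := by
    rw [← norm_pow]
    change ‖D.sqrtqX ^ 2‖ < 1
    rw [D.sqrtqX_sq]
    exact D.norm_qX_lt_one
  rw [h1, one_pow] at h2
  exact lt_irrefl _ h2

namespace KummerData

variable (E : D.KummerData)

/-- **The class `infl κ(q̈) ∈ H¹(Π^tp_Ÿ, Δ_Θ)` of the constant `q̈` is NOT a unit Kummer class**, for EVERY Kummer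
datum over EVERY theta setting: `K̈^× ↪ (K̈^×)^∧ ↪ H¹((Π^tp_Ÿ)^Θ, Δ_Θ) ↪ H¹(Π^tp_Ÿ, Δ_Θ)` is injective (interface
clauses + abc-iut-L2-t12's `inflTheta_injective`) and `q̈ ∉ O^×_K̈`. [cite: MochizukiEtTh2009, Prop 1.3 p.21] -/
theorem infl_kumYdd_qddUnit_not_mem_kumUnitsYdd :
    D.inflTheta D.GtpYdd (E.kumYdd (E.toKddHat D.qddUnit)) ∉ E.kumUnitsYdd := by
  rintro ⟨c, ⟨u, hu, rfl⟩, hcu⟩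
  have h1 : E.toKddHat u = E.toKddHat D.qddUnit :=
    E.kumYdd_injective (D.inflTheta_injective D.GtpYdd hcu)
  have h2 : u = D.qddUnit := E.toKddHat_injective h1
  exact D.qddUnit_not_mem_unitsOKdd (h2 ▸ hu)

/-- Hence `κ(O^×_K̈) ≠ ⊤` in `H¹(Π^tp_Ÿ, Δ_Θ)` for every Kummer datum. [cite: MochizukiEtTh2009, Prop 1.3 p.21] -/
theorem kumUnitsYdd_ne_top : E.kumUnitsYdd ≠ ⊤ := fun h =>
  E.infl_kumYdd_qddUnit_not_mem_kumUnitsYdd (h ▸ Subgroup.mem_top _)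

end KummerData

/-! ### F-0591: Prop. 1.5 (iii) as typed — the universal closure is FALSE (unguarded) -/

/-- **F-0591 at the χ-twisted root model**: Prop. 1.5 (iii) as typed FAILS for some étale-theta datum over
`ThetaSetting.modelχ p` (f-117's relative countermodel `η̈^Θ := 1` over `kummerDataχ`), so its closure over the
étale-theta data is false there — no hypothesis left. [cite: MochizukiEtTh2009, Prop 1.5 (iii) p.23] -/
theorem not_forall_prop15iii_modelχ (p : ℕ) [Fact p.Prime] :
    ¬ ∀ E : (ThetaSetting.modelχ p).EtaleThetaData, Prop15iii E (ThetaSetting.modelχ p).compat := by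
  rw [(ThetaSetting.modelχ p).forall_prop15iii_iff_isEmpty_kummerData (ThetaSetting.modelχ p).compat
    (ThetaSetting.modelχ_isEtThOrigin p), ← not_nonempty_iff]
  exact fun h => h (SettingModel.nonempty_kummerData_modelχ p)

/-- An explicit violating datum exists at the χ-model (`∃`-form of the preceding). [cite: MochizukiEtTh2009, Prop 1.5 (iii) p.23] -/
theorem exists_not_prop15iii_modelχ (p : ℕ) [Fact p.Prime] :
    ∃ E : (ThetaSetting.modelχ p).EtaleThetaData, E.toKummerData = SettingModel.kummerDataχ p ∧
      ¬ Prop15iii E (ThetaSetting.modelχ p).compat :=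
  (SettingModel.kummerDataχ p).exists_etaleThetaData_not_prop15iii (ThetaSetting.modelχ p).compat
    (ThetaSetting.modelχ_isEtThOrigin p)

/-- **F-0591, R5 verdict (UNGUARDED)**: the universal closure of the schema `Prop15iii` (all primes, all settings at an
[EtTh] origin with `Compat`, all étale-theta data) is FALSE — witness the χ-twisted root model at `p = 2`; this is the
left-hand side of f-117's `forall_prop15iii_iff_forall_isEmpty_kummerData`. [cite: MochizukiEtTh2009, Prop 1.5 (iii) p.23] -/
theorem not_forall_prop15iii :
    ¬ ∀ (p : ℕ) [Fact p.Prime] (D : ThetaSetting p) (hC : D.Compat) (_ : D.IsEtThOrigin) (E : D.EtaleThetaData),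
        Prop15iii E hC := by
  intro h
  haveI : Fact (Nat.Prime 2) := ⟨Nat.prime_two⟩
  exact not_forall_prop15iii_modelχ 2 fun E => h 2 (ThetaSetting.modelχ 2) _ (ThetaSetting.modelχ_isEtThOrigin 2) E

/-! ### F-0587: Thm. 1.6 (iii) as typed — the universal closure is FALSE (unguarded) -/

/-- **F-0587 over any setting carrying Kummer data**: at `γ = id` the closure of the typed Thm. 1.6 (iii) over the
étale-theta data FAILS as soon as `D` carries ONE Kummer datum `K` (f-114's exact reduction
`forall_thm16iii_refl_iff` needs `κ(O^×_K̈) = ⊤`, refuted by the class of `q̈`). [cite: MochizukiEtTh2009, Thm 1.6 (iii) p.24] -/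
theorem not_forall_thm16iii_refl_of_nonempty_kummerData (hC : D.Compat)
    (c : ThetaCompanion (ContinuousMulEquiv.refl D.PiTemp)) (h : Thm16i (ContinuousMulEquiv.refl D.PiTemp))
    (hK : Nonempty D.KummerData) :
    ¬ ∀ Eα Eβ : D.EtaleThetaData, Thm16iii (ContinuousMulEquiv.refl D.PiTemp) h c Eα Eβ hC := by
  obtain ⟨K⟩ := hK
  rw [forall_thm16iii_refl_iff hC c h]
  exact fun H => K.kumUnitsYdd_ne_top (H K)

/-- **F-0587 at the χ-twisted root model** (`γ = id`, identity companion): the closure over the étale-theta data is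
false there — no hypothesis left. [cite: MochizukiEtTh2009, Thm 1.6 (iii) p.24] -/
theorem not_forall_thm16iii_modelχ (p : ℕ) [Fact p.Prime] :
    ¬ ∀ Eα Eβ : (ThetaSetting.modelχ p).EtaleThetaData,
        Thm16iii (ContinuousMulEquiv.refl (ThetaSetting.modelχ p).PiTemp) (thm16i_refl (ThetaSetting.modelχ p))
          (ThetaCompanion.ofRefl (ThetaSetting.modelχ p)) Eα Eβ (ThetaSetting.modelχ p).compat :=
  not_forall_thm16iii_refl_of_nonempty_kummerData _ _ _ (SettingModel.nonempty_kummerData_modelχ p)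

/-- An explicit violating pair over `kummerDataχ` (`η̈_α := infl κ(q̈)`, `η̈_β := 1`). [cite: MochizukiEtTh2009, Thm 1.6 (iii) p.24] -/
theorem exists_not_thm16iii_modelχ (p : ℕ) [Fact p.Prime] :
    ∃ Eα Eβ : (ThetaSetting.modelχ p).EtaleThetaData,
      Eα.toKummerData = SettingModel.kummerDataχ p ∧ Eβ.toKummerData = SettingModel.kummerDataχ p ∧
      ¬ Thm16iii (ContinuousMulEquiv.refl (ThetaSetting.modelχ p).PiTemp) (thm16i_refl (ThetaSetting.modelχ p))
          (ThetaCompanion.ofRefl (ThetaSetting.modelχ p)) Eα Eβ (ThetaSetting.modelχ p).compat :=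
  (SettingModel.kummerDataχ p).exists_etaleThetaData_not_thm16iii_refl _ _ _
    (SettingModel.kummerDataχ p).infl_kumYdd_qddUnit_not_mem_kumUnitsYdd

/-- **F-0587, R5 verdict (UNGUARDED)**: for every prime `p` the universal closure of the schema `Thm16iii` over
all theta settings `Dα`, `Dβ : ThetaSetting p`, all `γ`, `h`, companions, étale-theta data and `Compat` is FALSE
(witness: `Dα = Dβ =` the χ-twisted root model, `γ = id`). [cite: MochizukiEtTh2009, Thm 1.6 (iii) p.24] -/
theorem not_forall_thm16iii (p : ℕ) [Fact p.Prime] :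
    ¬ ∀ (Dα Dβ : ThetaSetting p) (γ : Dα.PiTemp ≃ₜ* Dβ.PiTemp) (h : Thm16i γ) (c : ThetaCompanion γ)
        (Eα : Dα.EtaleThetaData) (Eβ : Dβ.EtaleThetaData) (hCβ : Dβ.Compat), Thm16iii γ h c Eα Eβ hCβ :=
  fun H => not_forall_thm16iii_modelχ p fun Eα Eβ => H _ _ _ _ _ Eα Eβ _

/-- **Instance form for F-0587** at the χ-model: Thm. 1.6 (iii) HOLDS at `γ = id` with the SAME étale-theta datum on
both sides (f-114's `thm16iii_refl_self`; `σ = 1`). [cite: MochizukiEtTh2009, Thm 1.6 (iii) p.24] -/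
theorem thm16iii_refl_self_modelχ (p : ℕ) [Fact p.Prime] (E : (ThetaSetting.modelχ p).EtaleThetaData) :
    Thm16iii (ContinuousMulEquiv.refl (ThetaSetting.modelχ p).PiTemp) (thm16i_refl (ThetaSetting.modelχ p))
      (ThetaCompanion.ofRefl (ThetaSetting.modelχ p)) E E (ThetaSetting.modelχ p).compat :=
  thm16iii_refl_self _ _ _ E

/-! ### Generic [EtTh] §1 bricks: Kummer cocycles of constants vanish at geometric elements -/

namespace KummerCore

variable (C : D.KummerCore)

/-- **Kummer cocycles of constants vanish at geometric elements.** For the Kummer data of a Kummer core (abc-iut-w5-d171: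
`kumYdd a` is the class of the continuous Kummer cocycle `h ↦ c((h·a^{1/n}/a^{1/n})_n)`, `h` acting through `augTheta`),
ANY cocycle representing `κ(a)` takes the value `1` at every `x ∈ (Π^tp_Ÿ)^Θ` with `augTheta x = 1` centralising `Δ_Θ`
(the Kummer cocycle vanishes there; evaluation at `x` is a class invariant). [cite: MochizukiEtTh2009, Prop 1.3 p.21] -/
theorem apply_eq_one_of_kumYdd_eq_mk (a : ↥C.invYdd)
    {f : ↥(D.GtpYdd.map D.toTheta) → ↥D.DeltaTheta}
    {hf : f ∈ contCocycles (MonoidHom.id D.GtpTheta) D.DeltaTheta (D.GtpYdd.map D.toTheta)}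
    (h : C.toKummerData.kumYdd a = ContH1.mk f hf) (x : ↥(D.GtpYdd.map D.toTheta))
    (haug : C.augTheta (x : D.GtpTheta) = 1) (hcen : ∀ d : ↥D.DeltaTheta, MulAut.conjNormal (x : D.GtpTheta) d = d) :
    f x = 1 := by
  letI := D.unitsAction C.augTheta
  have h1 : C.toKummerData.kumYdd a =
      ContH1.mk (fun h => C.coeff.hom ((RootSystem.ofRootableBy (a : (PadicAlgCl p)ˣ)).kummerCocycle a.2 h))
        (C.coeff.kummerContCocycle _ (RootSystem.ofRootableBy (a : (PadicAlgCl p)ˣ)) a.2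
          (fun _ => C.isOpen_stabilizer' _)).2 := rfl
  rw [h1] at h
  have h2 := ContH1.apply_eq_of_mk_eq_mk h x (fun d => by rw [MonoidHom.id_apply]; exact hcen d)
  rw [← h2]
  have h3 : (RootSystem.ofRootableBy (a : (PadicAlgCl p)ˣ)).kummerCocycle a.2 x = 1 := by
    refine Subtype.ext (funext fun n => ?_)
    rw [RootSystem.kummerCocycle_apply]
    change C.augTheta (x : D.GtpTheta) • (RootSystem.ofRootableBy (a : (PadicAlgCl p)ˣ)).root n /
      (RootSystem.ofRootableBy (a : (PadicAlgCl p)ˣ)).root n = _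
    rw [haug, one_smul, div_self']
    rfl
  rw [h3, map_one]

/-- `K̈^× → (ℚ̄_p^×)^{(Π^tp_Ÿ)^Θ}` is ONTO: an invariant unit is fixed by `augTheta((Π^tp_Ÿ)^Θ) = G_K̈`, hence lies in `K̈`;
so for the Kummer data of a core `toKddHat : K̈^× → (K̈^×)^∧` is a bijection. [cite: MochizukiEtTh2009, Prop 1.5 p.23] -/
theorem toInvYdd_surjective : Function.Surjective C.toInvYdd := by
  letI := D.unitsAction C.augTheta
  intro u
  have hmem : ((u : (PadicAlgCl p)ˣ) : PadicAlgCl p) ∈ D.Kdd := by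
    apply coe_mem_of_forall_fixingSubgroup D.Kdd
    rw [← C.map_augTheta_gtpYdd]
    exact (C.mem_invariants_iff _ _).mp u.2
  refine ⟨Units.mk0 ⟨((u : (PadicAlgCl p)ˣ) : PadicAlgCl p), hmem⟩ (fun h0 => ?_), ?_⟩
  · exact (u : (PadicAlgCl p)ˣ).ne_zero (congrArg Subtype.val h0)
  · exact Subtype.ext (Units.ext rfl)

end KummerCore

/-- The kernel `Ker((K̈^×)^∧ ↠ Ẑ)` of a valuation datum is DETERMINED whenever `K̈^× → (K̈^×)^∧` is onto (as for the
Kummer data of a core): the only typed constraint `K̈^× ∩ Ker = O^×_K̈` then pins it. [cite: MochizukiEtTh2009, Thm 1.6 (ii) p.24] -/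
theorem ValuationHatData.unitsHat_eq_of_surjective {E : D.KummerData} (hs : Function.Surjective E.toKddHat)
    (V V' : ValuationHatData D E) : V.unitsHat = V'.unitsHat := by
  ext z
  obtain ⟨a, rfl⟩ := hs z
  rw [V.mem_unitsHat_iff, V'.mem_unitsHat_iff]

end ThetaSetting

/-! ### F-0586 at the χ-twisted root model: `log(Ü)` is off-lattice -/

namespace SettingModel

open ThetaSetting

variable (p : ℕ) [Fact p.Prime]

/-- **`log(Ü)^k` is a Kummer class of a constant only for `k = 0`** at the χ-model: evaluate at the geometric element
`x = (b², 0) ⋊ 1 ∈ Π^tp_Ÿ` — Kummer cocycles of constants vanish at `x` (`aug x = 1`), coboundaries vanish at `x` (`x`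
centralises `Δ_Θ`, abc-iut-w5-d171 `conjNormal_toTheta_eq_self`), while the `log(Ü)`-cocycle takes the value
`c^{ŷ(x)/2} = c` there and `Δ_Θ ≅ Ẑ` is torsion-free. [cite: MochizukiEtTh2009, Prop 1.5 (ii) p.23] -/
theorem logUddχ_zpow_eq_kumYdd_imp {k : ℤ} {a : (kummerDataχ p).KddHat}
    (h : (kummerDataχ p).kumYdd a = (kummerDataχ p).logUdd ^ k) : k = 0 := by
  by_contra hk
  have hl : (kummerDataχ p).logUdd ^ k = ContH1.mk ((logUddFunχ p) ^ k) (zpow_mem (logUddFunχ_mem p) k) := by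
    show ContH1.mk (logUddFunχ p) (logUddFunχ_mem p) ^ k = _
    exact ContH1.mk_zpow _ _ k
  rw [hl] at h
  set x : PiTpχ p := SemidirectProduct.inl (bPowGfp (iotaZ (Multiplicative.ofAdd 2))) with hxdef
  have hx : CurveTheta.toTheta (curveχ p) x ∈
      (ThetaSetting.modelχ p).GtpYdd.map (ThetaSetting.modelχ p).toTheta :=
    ⟨x, inl_bPowGfp_two_mem_gtpYdd p, rfl⟩
  have haug : (kummerCoreχ p).augTheta
      ((⟨_, hx⟩ : ↥((ThetaSetting.modelχ p).GtpYdd.map (ThetaSetting.modelχ p).toTheta)) :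
        (ThetaSetting.modelχ p).GtpTheta) = 1 := by
    show CurveTheta.augTheta (curveχ p) (CurveTheta.toTheta (curveχ p) x) = 1
    rw [CurveTheta.augTheta_toTheta, hxdef]
    rfl
  have hcen : ∀ d : ↥(ThetaSetting.modelχ p).DeltaTheta,
      MulAut.conjNormal (((⟨_, hx⟩ : ↥((ThetaSetting.modelχ p).GtpYdd.map (ThetaSetting.modelχ p).toTheta)) :
        (ThetaSetting.modelχ p).GtpTheta)) d = d :=
    fun d => conjNormal_toTheta_eq_self p (x := x) (SemidirectProduct.right_inl _) d
  have h1 := (kummerCoreχ p).apply_eq_one_of_kumYdd_eq_mk a h ⟨_, hx⟩ haug hcen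
  -- `h1 : (logUddFunχ p ^ k) ⟨toTheta x, hx⟩ = 1`, i.e. `(c^{half ŷ(x)})^k = 1`
  set y : sqHom.range := ⟨yThetaχ p (CurveTheta.toTheta (curveχ p) x), yThetaχ_mem_range_sqHom p hx⟩ with hydef
  change (deltaThetaCoordχ p (half y)) ^ k = 1 at h1
  rw [← map_zpow] at h1
  have h2 : (half y) ^ k = 1 := (bijective_deltaThetaCoordχ p).1 (h1.trans (map_one (deltaThetaCoordχ p)).symm)
  have h3 : half y = 1 := Literature.AnabelianGeometry.AbsoluteAnabelian.ZHatCompletion.eq_one_of_pow_eq_one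
    (n := k.natAbs) (Int.natAbs_ne_zero.mpr hk) (pow_natAbs_eq_one.mpr h2)
  have h4 := half_sq y
  rw [h3, one_pow, hydef] at h4
  have h5 : yThetaχ p (CurveTheta.toTheta (curveχ p) x) = iotaZ (Multiplicative.ofAdd 2) := by
    rw [yThetaχ_toTheta]
    exact yCoordχ_inl_bPowGfp p _
  exact iotaZ_ofAdd_ne_one two_ne_zero (h5.symm.trans h4.symm)

/-- Equivalently: `log(Ü)^k ∈ κ((K̈^×)^∧)` forces `k = 0`. [cite: MochizukiEtTh2009, Prop 1.5 (ii) p.23] -/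
theorem logUddχ_zpow_mem_range_kumYdd_imp {k : ℤ}
    (h : (kummerDataχ p).logUdd ^ k ∈ Set.range (kummerDataχ p).kumYdd) : k = 0 :=
  h.elim fun _ ha => logUddχ_zpow_eq_kumYdd_imp p ha

/-- **An off-lattice Kummer datum over the χ-model (F-0586).** Extending `kummerDataχ` by the free factor generated by
`log(Ü)` — `KddHat := K̈^× × ℤ`, Kummer map `(a, k) ↦ κ(a) · log(Ü)^k` (injective by `logUddχ_zpow_eq_kumYdd_imp`; an
honest sub-object of `F̈² · Ẑ·log(Ü)`), other fields unchanged — is again a `KummerData`, and `z := log(Ü)` is OFF-LATTICE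
in it (`z ≠ 1`, no power `z^k ≠ 1` lies in `K̈^×`): the typed interface does not pin `(K̈^×)^∧` — the R5 point of the
row. [cite: MochizukiEtTh2009, Thm 1.6 (ii) p.24] -/
theorem exists_kummerData_offLattice_modelχ :
    ∃ (E : (ThetaSetting.modelχ p).KummerData) (z : E.KddHat),
      z ≠ 1 ∧ ∀ k : ℤ, z ^ k ∈ Set.range E.toKddHat → z ^ k = 1 := by
  have hinj : Function.Injective ((kummerDataχ p).kumYdd.coprod (zpowersHom _ (kummerDataχ p).logUdd)) := by
    rw [injective_iff_map_eq_one]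
    rintro ⟨a, m⟩ ham
    simp only [MonoidHom.coprod_apply, zpowersHom_apply] at ham
    rw [mul_eq_one_iff_eq_inv, ← zpow_neg] at ham
    have hm : -m.toAdd = 0 := logUddχ_zpow_eq_kumYdd_imp p ham
    rw [neg_eq_zero, toAdd_eq_zero] at hm
    rw [hm, toAdd_one, neg_zero, zpow_zero] at ham
    have ha : a = 1 := (kummerDataχ p).kumYdd_injective (ham.trans (map_one _).symm)
    rw [ha, hm]
    rfl
  refine ⟨{ KHat := (kummerDataχ p).KHat
            KddHat := (kummerDataχ p).KddHat × Multiplicative ℤ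
            toKHat := (kummerDataχ p).toKHat
            toKddHat := (MonoidHom.inl _ _).comp (kummerDataχ p).toKddHat
            toKHat_injective := (kummerDataχ p).toKHat_injective
            toKddHat_injective := fun a b hab => (kummerDataχ p).toKddHat_injective (congrArg Prod.fst hab)
            hatIncl := (MonoidHom.inl _ _).comp (kummerDataχ p).hatIncl
            hatIncl_toKHat := fun x y hxy => by
              show MonoidHom.inl _ _ ((kummerDataχ p).hatIncl ((kummerDataχ p).toKHat x)) =
                MonoidHom.inl _ _ ((kummerDataχ p).toKddHat y)
              rw [(kummerDataχ p).hatIncl_toKHat x y hxy]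
            kumY := (kummerDataχ p).kumY
            kumY_injective := (kummerDataχ p).kumY_injective
            kumYdd := (kummerDataχ p).kumYdd.coprod (zpowersHom _ (kummerDataχ p).logUdd)
            kumYdd_injective := hinj
            res_kumY := fun x => by
              rw [(kummerDataχ p).res_kumY x]
              simp only [MonoidHom.comp_apply, MonoidHom.inl_apply, MonoidHom.coprod_apply, zpowersHom_apply,
                toAdd_one, zpow_zero, mul_one]
            logU := (kummerDataχ p).logU
            logUdd := (kummerDataχ p).logUdd
            res_logU := (kummerDataχ p).res_logU }, (1, Multiplicative.ofAdd 1), ?_, fun k hk => ?_⟩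
  · intro h
    have h1 : Multiplicative.ofAdd (1 : ℤ) = 1 := congrArg Prod.snd h
    exact one_ne_zero (ofAdd_eq_one.mp h1)
  · obtain ⟨a, ha⟩ := hk
    have h1 : (1 : Multiplicative ℤ) = Multiplicative.ofAdd (1 : ℤ) ^ k := congrArg Prod.snd ha
    rw [← ofAdd_zsmul, smul_eq_mul, mul_one] at h1
    have hk0 : k = 0 := ofAdd_eq_one.mp h1.symm
    subst hk0
    exact zpow_zero _

/-- **F-0586 at the χ-model, relative form**: over the off-lattice datum the closure of the typed Thm. 1.6 (ii) over
its valuation PARAMETERS fails already at `γ = id` (two kernels `O^×_K̈` and `O^×_K̈·⟨log(Ü)⟩` satisfy the only typed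
constraint). [cite: MochizukiEtTh2009, Thm 1.6 (ii) p.24] -/
theorem exists_kummerData_not_forall_thm16ii_refl_modelχ :
    ∃ E : (ThetaSetting.modelχ p).KummerData, ¬ ∀ V V' : ValuationHatData (ThetaSetting.modelχ p) E,
      Thm16ii (ContinuousMulEquiv.refl (ThetaSetting.modelχ p).PiTemp) (thm16i_refl (ThetaSetting.modelχ p))
        E E V V' := by
  obtain ⟨E, z, hz1, hz⟩ := exists_kummerData_offLattice_modelχ p
  exact ⟨E, not_forall_thm16ii_refl_of_offLattice E hz1 hz⟩

/-- **Instance form for F-0586**: at `γ = id` with the GENUINE datum `kummerDataχ` on both sides, the typed Thm. 1.6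
(ii) HOLDS for ALL valuation data — its `K̈^× → (K̈^×)^∧` is onto, so the kernel is determined and f-114's exact form
`thm16ii_refl_iff` applies. [cite: MochizukiEtTh2009, Thm 1.6 (ii) p.24] -/
theorem thm16ii_refl_kummerDataχ (V V' : ValuationHatData (ThetaSetting.modelχ p) (kummerDataχ p)) :
    Thm16ii (ContinuousMulEquiv.refl (ThetaSetting.modelχ p).PiTemp) (thm16i_refl (ThetaSetting.modelχ p))
      (kummerDataχ p) (kummerDataχ p) V V' :=
  (thm16ii_refl_iff _ V V').mpr
    (ValuationHatData.unitsHat_eq_of_surjective ((kummerCoreχ p).toInvYdd_surjective) V V')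

end SettingModel

namespace ThetaSetting

/-- **F-0586 at the χ-twisted root model**: the closure of the typed Thm. 1.6 (ii) over the Kummer and valuation
data is false there — no hypothesis left. [cite: MochizukiEtTh2009, Thm 1.6 (ii) p.24] -/
theorem not_forall_thm16ii_modelχ (p : ℕ) [Fact p.Prime] :
    ¬ ∀ (Eα Eβ : (ThetaSetting.modelχ p).KummerData) (Vα : ValuationHatData _ Eα) (Vβ : ValuationHatData _ Eβ),
        Thm16ii (ContinuousMulEquiv.refl (ThetaSetting.modelχ p).PiTemp) (thm16i_refl (ThetaSetting.modelχ p))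
          Eα Eβ Vα Vβ := by
  obtain ⟨E, hE⟩ := SettingModel.exists_kummerData_not_forall_thm16ii_refl_modelχ p
  exact fun H => hE fun V V' => H E E V V'

/-- **F-0586, R5 verdict (UNGUARDED)**: for every prime `p` the universal closure of the schema `Thm16ii` over all
theta settings `Dα`, `Dβ : ThetaSetting p`, all `γ`, `h`, Kummer data and valuation data is FALSE (witness: the
χ-twisted root model, `γ = id`, the off-lattice datum; f-114's `not_forall_thm16ii_of_offLattice` with its
existential guard discharged). [cite: MochizukiEtTh2009, Thm 1.6 (ii) p.24] -/
theorem not_forall_thm16ii (p : ℕ) [Fact p.Prime] :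
    ¬ ∀ (Dα Dβ : ThetaSetting p) (γ : Dα.PiTemp ≃ₜ* Dβ.PiTemp) (h : Thm16i γ) (Eα : Dα.KummerData)
        (Eβ : Dβ.KummerData) (Vα : ValuationHatData Dα Eα) (Vβ : ValuationHatData Dβ Eβ),
        Thm16ii γ h Eα Eβ Vα Vβ := by
  obtain ⟨E, z, hz1, hz⟩ := SettingModel.exists_kummerData_offLattice_modelχ p
  exact not_forall_thm16ii_of_offLattice ⟨ThetaSetting.modelχ p, E, z, hz1, hz⟩

end ThetaSetting

end Literature.AnabelianGeometry.EtaleTheta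

end
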